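import Summits.NavierStokesRegularity.NavierStokesRegularity.Theorems.SwirlFreeBudgetLocalDictionary
import Summits.NavierStokesRegularity.NavierStokesRegularity.Theorems.AxisymmetricExtremalityAxisymmetricKatoGlobalStubSeregin2020TypeIINoSwirlCore
import HarnessLib

/-!
# SwirlFreeBudget, toward crux K-18.1 `EtaMoserBound` (T-18.2): local calculus of `η = ω_θ/r`
# (`angVortQuot`) for fields smooth on an axis-centred ball (seat nsreg-p4 g12)

Support file for the DORMANT route `SwirlThreshold` (crux stmt-NavierStokesRegularity-2002) and
planner nsreg-p2's ROUND-18 Appendix A.  The Moser bricks (`…MoserChain`, `…MoserAbsorb`,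
`…MoserStart`) are about an arbitrary measurable `g`; to apply them to `g = η = angVortQuot (V t)`
for the Seregin–Zajączkowski class on an axis-centred cylinder one needs, slice by slice, the
classical facts about `η` for a field `V` which is `C^∞` on an axis-centred BALL only (and
axisymmetric, swirl free everywhere — the globalised representative of T-18.5).  Via g11's
globalisation `exists_contDiff_axisymmetric_hasNoSwirl_eqOn` and the locality of the radial
quotient `radQuot_congr_of_eqOn_ball`, the tree's global dictionary transfers:

* `cylRadius_sq_mul_angVortQuot_of_ball` — `r² η = swirl (curl V)` on the ball (so
  `η = (x₀ω₁ - x₁ω₀)/r²` off the axis);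
* `continuousOn_angVortQuot_of_ball` — `η` is continuous on the ball (across the axis);
* `norm_hadamardQuotFst_le_of_segment` — Hadamard's quotient is bounded by the derivative along
  the segment `{(s x₀, x₁, x₂)}` only;
* `abs_angVortQuot_le_of_ball` — **`|η(x)| ≤ C · sup ‖D²V‖`** over the points of the ball no
  farther from the centre than `x` (`C` an absolute constant): `η` is bounded on compact axis-centred
  sub-balls by the second derivatives of `V` — the a-priori finiteness the Moser iteration needs.

WHAT THIS IS NOT: not NS regularity — calculus; `EtaMoserBound` stays OPEN; no crux claim.
-/

namespace Summit.NavierStokesRegularity.NavierStokesRegularity.Theorems.SwirlFreeBudget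

open MeasureTheory Set Filter Topology Metric Function
open scoped ENNReal NNReal
open Literature.Analysis Literature.Analysis.FluidPDE
open Summit.NavierStokesRegularity.NavierStokesRegularity.Theorems.AxisymmetricKatoGlobal.EulerScaling

noncomputable section

/-- Shrinking the first coordinate does not increase the distance to an axis point:
`dist (s x₀, x₁, x₂) c ≤ dist x c` for `s ∈ [0, 1]`, `c` on the axis. -/
theorem dist_scaleFst_le_of_axis {c : EuclideanSpace ℝ (Fin 3)} (hc : cylRadius c = 0) {s : ℝ}
    (hs : s ∈ Icc (0 : ℝ) 1) (x : EuclideanSpace ℝ (Fin 3)) : dist (scaleFst s x) c ≤ dist x c := by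
  have h := dist_scaleFst_scaleH_le hc hs ⟨zero_le_one, le_rfl⟩ x
  rwa [scaleH_one] at h

/-- **Hadamard's quotient is controlled along the segment only**: if `‖Dw(s x₀, x₁, x₂)‖ ≤ B` for
all `s ∈ [0,1]` (`B ≥ 0`) then `‖hadamardQuotFst w x‖ ≤ B`. -/
theorem norm_hadamardQuotFst_le_of_segment {F : Type*} [NormedAddCommGroup F] [NormedSpace ℝ F]
    {w : EuclideanSpace ℝ (Fin 3) → F} {B : ℝ} {x : EuclideanSpace ℝ (Fin 3)} (hB : 0 ≤ B)
    (h : ∀ s ∈ Icc (0 : ℝ) 1, ‖fderiv ℝ w (scaleFst s x)‖ ≤ B) : ‖hadamardQuotFst w x‖ ≤ B := by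
  unfold hadamardQuotFst
  have key := intervalIntegral.norm_integral_le_of_norm_le_const (a := (0 : ℝ)) (b := 1) (C := B)
    (f := fun s => fderiv ℝ w (scaleFst s x) (EuclideanSpace.single 0 1)) fun s hs => ?_
  · simpa using key
  · rw [uIoc_of_le zero_le_one] at hs
    calc ‖fderiv ℝ w (scaleFst s x) (EuclideanSpace.single 0 1)‖
        ≤ ‖fderiv ℝ w (scaleFst s x)‖ * ‖(EuclideanSpace.single (0 : Fin 3) (1 : ℝ))‖ :=
          ContinuousLinearMap.le_opNorm _ _
      _ ≤ B * 1 := by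
          refine mul_le_mul (h s ⟨hs.1.le, hs.2⟩) ?_ (norm_nonneg _) hB
          rw [PiLp.norm_single, norm_one]
      _ = B := mul_one B

section Ball

variable {V : EuclideanSpace ℝ (Fin 3) → EuclideanSpace ℝ (Fin 3)} {c : EuclideanSpace ℝ (Fin 3)} {R : ℝ}

/-- The globalisation package at a point of the ball: a radius `R'` with `dist x c < R' < R` and a
global `Cⁿ` axisymmetric swirl-free `W` equal to `V` on `ball c R'`; in particular
`angVortQuot V = angVortQuot W` and `curl V = curl W` on `ball c R'`. -/
theorem exists_globalisation_at {n : ℕ∞} (hc : cylRadius c = 0) (hV : ContDiffOn ℝ n V (ball c R))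
    (hax : IsAxisymmetric V) (hsw : HasNoSwirl V) {x : EuclideanSpace ℝ (Fin 3)} (hx : x ∈ ball c R) :
    ∃ R' : ℝ, dist x c < R' ∧ R' < R ∧ ∃ W : EuclideanSpace ℝ (Fin 3) → EuclideanSpace ℝ (Fin 3),
      ContDiff ℝ n W ∧ IsAxisymmetric W ∧ HasNoSwirl W ∧ EqOn W V (ball c R') ∧
      (∀ y ∈ ball c R', curl W y = curl V y) ∧
      ∀ y ∈ ball c R', angVortQuot V y = angVortQuot W y := by
  obtain ⟨R', hxR', hR'R⟩ := exists_between (mem_ball.1 hx)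
  have hR'0 : 0 < R' := lt_of_le_of_lt dist_nonneg hxR'
  obtain ⟨W, hW, hWax, hWsw, hWV⟩ := exists_contDiff_axisymmetric_hasNoSwirl_eqOn hc hR'0 hR'R hV hax hsw
  have hcurl : ∀ y ∈ ball c R', curl W y = curl V y := fun y hy =>
    curl_congr_of_eventuallyEq (hWV.eventuallyEq_of_mem (isOpen_ball.mem_nhds hy))
  have hswirl : EqOn (swirl (curl V)) (swirl (curl W)) (ball c R') := fun y hy => by
    simp only [swirl, hcurl y hy]
  refine ⟨R', hxR', hR'R, W, hW, hWax, hWsw, hWV, hcurl, fun y hy => ?_⟩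
  unfold angVortQuot
  exact radQuot_congr_of_eqOn_ball hc hswirl hy

/-- **`r² η = swirl (curl V)` on an axis-centred ball** for `V` of class `C³` there, axisymmetric
and swirl free (so `η = swirl(ω)/r²` off the axis). -/
theorem cylRadius_sq_mul_angVortQuot_of_ball (hc : cylRadius c = 0) (hV : ContDiffOn ℝ 3 V (ball c R))
    (hax : IsAxisymmetric V) (hsw : HasNoSwirl V) {x : EuclideanSpace ℝ (Fin 3)} (hx : x ∈ ball c R) :
    cylRadius x ^ 2 * angVortQuot V x = swirl (curl V) x := by
  obtain ⟨R', hxR', -, W, hW, hWax, -, -, hcurl, hq⟩ := exists_globalisation_at hc hV hax hsw hx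
  have hxR : x ∈ ball c R' := mem_ball.2 hxR'
  rw [hq x hxR, hWax.cylRadius_sq_mul_angVortQuot hW x]
  simp only [swirl, hcurl x hxR]

/-- **`η` is continuous on the ball** (across the axis): for `V` of class `C³` on `ball c R`,
axisymmetric and swirl free. -/
theorem continuousOn_angVortQuot_of_ball (hc : cylRadius c = 0) (hV : ContDiffOn ℝ 3 V (ball c R))
    (hax : IsAxisymmetric V) (hsw : HasNoSwirl V) : ContinuousOn (angVortQuot V) (ball c R) := by
  intro x hx
  obtain ⟨R', hxR', -, W, hW, -, -, -, -, hq⟩ := exists_globalisation_at hc hV hax hsw hx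
  have hxR : x ∈ ball c R' := mem_ball.2 hxR'
  have hWc : Continuous (angVortQuot W) :=
    (contDiff_angVortQuot (n := 0) (by exact_mod_cast hW)).continuous
  have hev : angVortQuot V =ᶠ[𝓝 x] angVortQuot W :=
    Filter.eventuallyEq_of_mem (isOpen_ball.mem_nhds hxR) fun y hy => hq y hy
  exact (hWc.continuousAt.congr_of_eventuallyEq hev).continuousWithinAt

/-- **`η` is bounded by the second derivatives of `V`**: there is an absolute constant `C ≥ 0` such
that for `V` of class `C^∞` on `ball c R` (`c` on the axis), axisymmetric and swirl free, every
`x ∈ ball c R` and every `K₂` bounding `‖D²V(y)‖` at the points `y` of the ball with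
`dist y c ≤ dist x c`: `|angVortQuot V x| ≤ C K₂`.  (Via `η = hadamardQuotFst(ω₁)` for the
globalisation and `curl_bounds_of_iteratedFDeriv_bounds` along the segment `(s x₀, x₁, x₂)`.) -/
theorem abs_angVortQuot_le_of_ball :
    ∃ C : ℝ, 0 ≤ C ∧ ∀ (V : EuclideanSpace ℝ (Fin 3) → EuclideanSpace ℝ (Fin 3))
      (c : EuclideanSpace ℝ (Fin 3)) (R : ℝ), cylRadius c = 0 →
      ContDiffOn ℝ (⊤ : ℕ∞) V (ball c R) → IsAxisymmetric V → HasNoSwirl V →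
      ∀ x ∈ ball c R, ∀ K₂ : ℝ, 0 ≤ K₂ →
        (∀ y ∈ ball c R, dist y c ≤ dist x c → ‖iteratedFDeriv ℝ 2 V y‖ ≤ K₂) →
        |angVortQuot V x| ≤ C * K₂ := by
  set Cc : ℝ := ‖((EuclideanSpace.proj (1 : Fin 3) : EuclideanSpace ℝ (Fin 3) →L[ℝ] ℝ).comp curlCLM)‖
    with hCc
  have hCc0 : 0 ≤ Cc := norm_nonneg
    (((EuclideanSpace.proj (1 : Fin 3) : EuclideanSpace ℝ (Fin 3) →L[ℝ] ℝ).comp curlCLM))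
  refine ⟨Cc, hCc0, ?_⟩
  intro V c R hc hV hax hsw x hx K₂ hK₂ hD
  obtain ⟨R', hxR', hR'R, W, hW, hWax, hWsw, hWV, -, hq⟩ := exists_globalisation_at hc hV hax hsw hx
  have hxR : x ∈ ball c R' := mem_ball.2 hxR'
  have hW3 : ContDiff ℝ 3 W := hW.of_le (by norm_cast)
  rw [hq x hxR, angVortQuot_eq_hadamardQuotFst_curl hWax hWsw hW3]
  change |hadamardQuotFst (fun y => curl W y 1) x| ≤ _
  rw [← Real.norm_eq_abs]
  refine norm_hadamardQuotFst_le_of_segment (by positivity) fun s hs => ?_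
  -- the point `(s x₀, x₁, x₂)` lies in `ball c R'`, where `W = V` near it
  have hy : scaleFst s x ∈ ball c R' :=
    mem_ball.2 (lt_of_le_of_lt (dist_scaleFst_le_of_axis hc hs x) hxR')
  have hyR : scaleFst s x ∈ ball c R := ball_subset_ball hR'R.le hy
  have hWVy : W =ᶠ[𝓝 (scaleFst s x)] V := hWV.eventuallyEq_of_mem (isOpen_ball.mem_nhds hy)
  exact (curl_bounds_of_iteratedFDeriv_bounds hW hWVy le_rfl
    (hD _ hyR (dist_scaleFst_le_of_axis hc hs x))).2

end Ball

end

end Summit.NavierStokesRegularity.NavierStokesRegularity.Theorems.SwirlFreeBudget
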